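import Mathlib
import Literature.Analysis.FluidPDE.SelfSimilarEulerTrappedTrajectories
import HarnessLib.Audit

/-!
# Rung C1 of the crux `EulerZoomLiouville.PowerGaugeEulerLiouville` (W3b portrait, kit 1/3): the trapped-trajectory lemmas
# of CIV §3.4.3 for HALF-ORBITS — the ODE is assumed for `t ≥ 0` only

Route №10 `EulerZoomLiouville` (NavierStokesRegularity), crux E = stmt-NavierStokesRegularity-19832, tenure rung C1,
registered residue `stub_selfSimilarExtremalRest`, sub-stratum W3b.  Lineage ns-typeII-p1 (gen 8).

The Literature lemmas `IsSelfSimilarEulerProfile.bernoulli_comp_sub_eq`, `exists_integral_norm_transport_sq_le`,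
`tendsto_transport_comp_of_bounded` (`SelfSimilarEulerTrappedTrajectories.lean`) are stated for curves solving
`Y' = σ V(Y)` for ALL real `t`, although their proofs only evaluate the equation at `t ≥ 0` (fix (F1) of the W3a plan of
the 19832 lead, HOME/ns-typeII-p2/W3a-PLAN-19832.md).  For a `C²` profile WITHOUT growth control at infinity the forward
similarity orbit of a point may blow up in finite time, so a globally defined `V`-curve through a point need not exist,
while the backward half-orbit of a point whose backward orbit is bounded is a perfectly good half-curve.  This file
re-proves the three lemmas verbatim for a continuous curve `Y : ℝ → ℝ³` solving the ODE on `[0, ∞)` only: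

* `bernoulli_comp_sub_eq_of_Ici` — `ℋ(Y(b)) − ℋ(Y(a)) = σ(2γ−1) ∫_a^b |V(Y)|²` for `0 ≤ a ≤ b`;
* `exists_integral_norm_transport_sq_le_of_Ici` — bounded half-orbits have square-integrable speed (`γ ≠ ½`);
* `tendsto_transport_comp_of_bounded_of_Ici` — and come to rest: `V(Y(t)) → 0` (Barbalat).

Consumers: `…SelfSimilarHalfOrbitKill` (the limit-set kill on half-orbits) and `…SelfSimilarVorticalEscape` (a.e. vortical
point of a `C²` profile has an UNBOUNDED backward similarity orbit).

WHAT THIS IS NOT: not NS, not E, not rung C1 — Lagrangian bookkeeping. [cite: ConstantinIgnatovaVicol2026Putative, §3.4.3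
eq. (3.31)–(3.33), Rem. 3.6]
-/

noncomputable section

-- flat `Theorems/<Route><Decl>…` files of one crux share the namespace of the crux (tree convention)
set_option linter.dupNamespace false

open Set Filter Topology InnerProductSpace Metric MeasureTheory
open scoped RealInnerProductSpace Interval

namespace Summit.NavierStokesRegularity.NavierStokesRegularity.Theorems.PowerGaugeEulerLiouville.HalfOrbit

open Literature.Analysis Literature.Analysis.FluidPDE

variable {γ : ℝ} {c : EuclideanSpace ℝ (Fin 3)}
  {U : EuclideanSpace ℝ (Fin 3) → EuclideanSpace ℝ (Fin 3)} {P : EuclideanSpace ℝ (Fin 3) → ℝ}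

/-- The transport field `V = γ(y − c) + U` of a profile is continuous. [folklore] -/
theorem continuous_transport (h : IsSelfSimilarEulerProfile γ c U P) :
    Continuous (selfSimilarTransport γ c U) := by
  have e : selfSimilarTransport γ c U = fun y => γ • (y - c) + U y := rfl
  rw [e]
  exact ((continuous_id.sub continuous_const).const_smul γ).add h.contDiff_velocity.continuous

/-- **The speed-square integral along a half-trajectory** (`0 ≤ a ≤ b`; ODE on `[0,∞)` only):
`ℋ(Y(b)) − ℋ(Y(a)) = σ(2γ−1) ∫_a^b |V(Y(t))|² dt`. [cite: ConstantinIgnatovaVicol2026Putative, §3.4.3 eq. (3.31)] -/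
theorem bernoulli_comp_sub_eq_of_Ici (h : IsSelfSimilarEulerProfile γ c U P) {σ : ℝ}
    {Y : ℝ → EuclideanSpace ℝ (Fin 3)} (hYc : Continuous Y)
    (hY : ∀ t, 0 ≤ t → HasDerivAt Y (σ • selfSimilarTransport γ c U (Y t)) t)
    {a b : ℝ} (ha : 0 ≤ a) (hab : a ≤ b) :
    selfSimilarBernoulli γ c U P (Y b) - selfSimilarBernoulli γ c U P (Y a) =
      σ * (2 * γ - 1) * ∫ t in a..b, ‖selfSimilarTransport γ c U (Y t)‖ ^ 2 := by
  have hgc : Continuous fun t => σ * ((2 * γ - 1) * ‖selfSimilarTransport γ c U (Y t)‖ ^ 2) :=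
    continuous_const.mul (continuous_const.mul (((continuous_transport h).comp hYc).norm.pow 2))
  have hHd : Differentiable ℝ (selfSimilarBernoulli γ c U P) :=
    h.contDiff_selfSimilarBernoulli.differentiable one_ne_zero
  have hder : ∀ t ∈ uIcc a b, HasDerivAt (fun s => selfSimilarBernoulli γ c U P (Y s))
      (σ * ((2 * γ - 1) * ‖selfSimilarTransport γ c U (Y t)‖ ^ 2)) t := by
    intro t ht
    rw [uIcc_of_le hab] at ht
    have h1 : HasDerivAt (fun s => selfSimilarBernoulli γ c U P (Y s))
        (fderiv ℝ (selfSimilarBernoulli γ c U P) (Y t) (σ • selfSimilarTransport γ c U (Y t))) t :=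
      (hHd (Y t)).hasFDerivAt.comp_hasDerivAt t (hY t (ha.trans ht.1))
    rw [map_smul, h.fderiv_selfSimilarBernoulli_transport (Y t), smul_eq_mul] at h1
    exact h1
  have key := intervalIntegral.integral_eq_sub_of_hasDerivAt hder (hgc.intervalIntegrable a b)
  rw [← key, intervalIntegral.integral_const_mul, intervalIntegral.integral_const_mul, mul_assoc]

/-- **Bounded half-trajectories have square-integrable speed** (`γ ≠ ½`, `σ ≠ 0`; ODE on `[0,∞)` only): if `‖Y(t)‖ ≤ B` for
`t ≥ 0`, then `∫_a^b |V(Y)|² ≤ 2 sup_{B̄_B}|ℋ| / |σ(2γ−1)|` for all `0 ≤ a ≤ b`.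
[cite: ConstantinIgnatovaVicol2026Putative, §3.4.3 eq. (3.31)–(3.33)] -/
theorem exists_integral_norm_transport_sq_le_of_Ici (h : IsSelfSimilarEulerProfile γ c U P) (hγ : γ ≠ 1 / 2)
    {σ : ℝ} (hσ : σ ≠ 0) {Y : ℝ → EuclideanSpace ℝ (Fin 3)} (hYc : Continuous Y)
    (hY : ∀ t, 0 ≤ t → HasDerivAt Y (σ • selfSimilarTransport γ c U (Y t)) t) {B : ℝ}
    (hB : ∀ t, 0 ≤ t → ‖Y t‖ ≤ B) :
    ∃ C : ℝ, ∀ a b : ℝ, 0 ≤ a → a ≤ b → ∫ t in a..b, ‖selfSimilarTransport γ c U (Y t)‖ ^ 2 ≤ C := by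
  obtain ⟨M, hM⟩ := (isCompact_closedBall (0 : EuclideanSpace ℝ (Fin 3)) B).exists_bound_of_continuousOn
    h.contDiff_selfSimilarBernoulli.continuous.continuousOn
  have hκ : σ * (2 * γ - 1) ≠ 0 := mul_ne_zero hσ (by intro h0; apply hγ; linarith)
  refine ⟨2 * M / |σ * (2 * γ - 1)|, fun a b ha hab => ?_⟩
  have e := bernoulli_comp_sub_eq_of_Ici h hYc hY ha hab
  have hMa : ‖selfSimilarBernoulli γ c U P (Y a)‖ ≤ M := hM _ (mem_closedBall_zero_iff.2 (hB a ha))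
  have hMb : ‖selfSimilarBernoulli γ c U P (Y b)‖ ≤ M := hM _ (mem_closedBall_zero_iff.2 (hB b (ha.trans hab)))
  have h1 : |σ * (2 * γ - 1) * ∫ t in a..b, ‖selfSimilarTransport γ c U (Y t)‖ ^ 2| ≤ 2 * M := by
    rw [← e]
    rw [Real.norm_eq_abs] at hMa hMb
    calc |selfSimilarBernoulli γ c U P (Y b) - selfSimilarBernoulli γ c U P (Y a)|
        ≤ |selfSimilarBernoulli γ c U P (Y b)| + |selfSimilarBernoulli γ c U P (Y a)| := abs_sub _ _
      _ ≤ M + M := add_le_add hMb hMa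
      _ = 2 * M := by ring
  rw [abs_mul] at h1
  have hpos : 0 < |σ * (2 * γ - 1)| := abs_pos.2 hκ
  rw [le_div_iff₀ hpos]
  calc (∫ t in a..b, ‖selfSimilarTransport γ c U (Y t)‖ ^ 2) * |σ * (2 * γ - 1)|
      ≤ |∫ t in a..b, ‖selfSimilarTransport γ c U (Y t)‖ ^ 2| * |σ * (2 * γ - 1)| :=
        mul_le_mul_of_nonneg_right (le_abs_self _) hpos.le
    _ = |σ * (2 * γ - 1)| * |∫ t in a..b, ‖selfSimilarTransport γ c U (Y t)‖ ^ 2| := mul_comm _ _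
    _ ≤ 2 * M := h1

/-- **Trapped half-trajectories come to rest (`γ ≠ ½`; ODE on `[0,∞)` only).**  Let `(U, P)` be a self-similar Euler profile with
`γ ≠ ½` and `Y` a solution of `Y' = σ V(Y)` (`σ ≠ 0`; `σ = −1` for backward trajectories of `V`) which stays in
the ball `‖Y(t)‖ ≤ B` for `t ≥ 0`.  Then `V(Y(t)) → 0` as `t → ∞`.  Proof (Barbalat): `t ↦ |V(Y(t))|` is
Lipschitz (`Y'` bounded, `V` Lipschitz on the ball) and square-integrable on `[0, ∞)` by
`exists_integral_norm_transport_sq_le`; a Lipschitz function that is `≥ ε` at arbitrarily late times has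
speed-square integral `≥ δε²/4` on arbitrarily late windows, contradicting the Cauchy property of
`T ↦ ∫_0^T |V(Y)|²`. [cite: ConstantinIgnatovaVicol2026Putative, §3.4.3 eq. (3.31)–(3.33) and Rem. 3.6] -/
theorem tendsto_transport_comp_of_bounded_of_Ici (h : IsSelfSimilarEulerProfile γ c U P) (hγ : γ ≠ 1 / 2)
    {σ : ℝ} (hσ : σ ≠ 0) {Y : ℝ → EuclideanSpace ℝ (Fin 3)} (hYc : Continuous Y)
    (hY : ∀ t, 0 ≤ t → HasDerivAt Y (σ • selfSimilarTransport γ c U (Y t)) t) {B : ℝ}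
    (hB : ∀ t, 0 ≤ t → ‖Y t‖ ≤ B) :
    Tendsto (fun t => selfSimilarTransport γ c U (Y t)) atTop (𝓝 0) := by
  have hVc := continuous_transport h
  set g : ℝ → ℝ := fun t => ‖selfSimilarTransport γ c U (Y t)‖ with hg
  have hgc : Continuous g := (hVc.comp hYc).norm
  -- bounds on the ball: speed `S`, Lipschitz constant `L` of `U`
  obtain ⟨S, hS⟩ := (isCompact_closedBall (0 : EuclideanSpace ℝ (Fin 3)) B).exists_bound_of_continuousOn
    hVc.continuousOn
  obtain ⟨L, hL⟩ := (isCompact_closedBall (0 : EuclideanSpace ℝ (Fin 3)) B).exists_bound_of_continuousOn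
    ((h.contDiff_velocity.continuous_fderiv (by norm_num)).continuousOn)
  have hS0 : 0 ≤ S := (norm_nonneg _).trans (hS (Y 0) (mem_closedBall_zero_iff.2 (hB 0 le_rfl)))
  have hL0 : 0 ≤ L := (norm_nonneg _).trans (hL (Y 0) (mem_closedBall_zero_iff.2 (hB 0 le_rfl)))
  -- `Y` is `|σ| S`-Lipschitz on `[0, ∞)`
  have hYlip : ∀ s t : ℝ, 0 ≤ s → s ≤ t → ‖Y t - Y s‖ ≤ |σ| * S * (t - s) := by
    intro s t hs hst
    have key := Convex.norm_image_sub_le_of_norm_hasDerivWithin_le (f := Y) (s := Ici (0 : ℝ))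
      (C := |σ| * S) (fun x hx => (hY x hx).hasDerivWithinAt) (fun x hx => ?_) (convex_Ici 0) (mem_Ici.2 hs)
      (mem_Ici.2 (hs.trans hst))
    · rw [Real.norm_eq_abs, abs_of_nonneg (sub_nonneg.2 hst)] at key
      exact key
    · rw [norm_smul, Real.norm_eq_abs]
      exact mul_le_mul_of_nonneg_left (hS _ (mem_closedBall_zero_iff.2 (hB x hx))) (abs_nonneg _)
  -- `V` is `(|γ| + L)`-Lipschitz on the ball
  have hVlip : ∀ x y : EuclideanSpace ℝ (Fin 3), ‖x‖ ≤ B → ‖y‖ ≤ B →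
      ‖selfSimilarTransport γ c U y - selfSimilarTransport γ c U x‖ ≤ (|γ| + L) * ‖y - x‖ := by
    intro x y hx hy
    have hU : ‖U y - U x‖ ≤ L * ‖y - x‖ :=
      Convex.norm_image_sub_le_of_norm_fderiv_le (fun z _ => h.differentiable_velocity z)
        (fun z hz => hL z hz) (convex_closedBall 0 B) (mem_closedBall_zero_iff.2 hx)
        (mem_closedBall_zero_iff.2 hy)
    have e : selfSimilarTransport γ c U y - selfSimilarTransport γ c U x = γ • (y - x) + (U y - U x) := by
      simp only [selfSimilarTransport_apply, smul_sub]
      abel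
    rw [e]
    calc ‖γ • (y - x) + (U y - U x)‖ ≤ ‖γ • (y - x)‖ + ‖U y - U x‖ := norm_add_le _ _
      _ ≤ |γ| * ‖y - x‖ + L * ‖y - x‖ := by
          rw [norm_smul, Real.norm_eq_abs]
          exact add_le_add le_rfl hU
      _ = (|γ| + L) * ‖y - x‖ := by ring
  -- hence `g` is Lipschitz in time on `[0, ∞)` with constant `Λ = (|γ| + L) |σ| S`
  set Λ : ℝ := (|γ| + L) * (|σ| * S) with hΛ
  have hΛ0 : 0 ≤ Λ := by positivity
  have hglip : ∀ s t : ℝ, 0 ≤ s → s ≤ t → |g t - g s| ≤ Λ * (t - s) := by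
    intro s t hs hst
    calc |g t - g s| ≤ ‖selfSimilarTransport γ c U (Y t) - selfSimilarTransport γ c U (Y s)‖ :=
          abs_norm_sub_norm_le _ _
      _ ≤ (|γ| + L) * ‖Y t - Y s‖ := hVlip _ _ (hB s hs) (hB t (hs.trans hst))
      _ ≤ (|γ| + L) * (|σ| * S * (t - s)) := mul_le_mul_of_nonneg_left (hYlip s t hs hst) (by positivity)
      _ = Λ * (t - s) := by rw [hΛ]; ring
  -- the speed-square integral `I(T) = ∫_0^T g²` is nondecreasing and bounded, hence Cauchy
  obtain ⟨C, hC⟩ := exists_integral_norm_transport_sq_le_of_Ici h hγ hσ hYc hY hB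
  set I : ℝ → ℝ := fun T => ∫ t in (0 : ℝ)..T, g t ^ 2 with hI
  have hgi : ∀ a b : ℝ, IntervalIntegrable (fun t => g t ^ 2) volume a b :=
    fun a b => (hgc.pow 2).intervalIntegrable a b
  have hImono : Monotone fun T : ℝ => I (max T 0) := by
    intro T₁ T₂ h12
    have hm : max T₁ 0 ≤ max T₂ 0 := max_le_max h12 le_rfl
    show I (max T₁ 0) ≤ I (max T₂ 0)
    rw [hI]
    simp only
    rw [← intervalIntegral.integral_add_adjacent_intervals (hgi 0 (max T₁ 0)) (hgi (max T₁ 0) (max T₂ 0))]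
    have : 0 ≤ ∫ t in max T₁ 0..max T₂ 0, g t ^ 2 :=
      intervalIntegral.integral_nonneg hm fun t _ => sq_nonneg _
    linarith
  have hIbdd : BddAbove (range fun T : ℝ => I (max T 0)) := by
    refine ⟨C, ?_⟩
    rintro _ ⟨T, rfl⟩
    exact hC 0 (max T 0) le_rfl (le_max_right _ _)
  have hIlim : Tendsto (fun T : ℝ => I (max T 0)) atTop (𝓝 (⨆ T : ℝ, I (max T 0))) :=
    tendsto_atTop_ciSup hImono hIbdd
  -- Barbalat: `g → 0`
  rw [tendsto_zero_iff_norm_tendsto_zero]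
  change Tendsto g atTop (𝓝 0)
  rw [Metric.tendsto_atTop]
  intro ε hε
  by_contra hcon
  push Not at hcon
  -- window length `δ` with `Λ δ ≤ ε/2`
  obtain ⟨δ, hδ0, hδ⟩ : ∃ δ : ℝ, 0 < δ ∧ Λ * δ ≤ ε / 2 := by
    by_cases hΛz : Λ = 0
    · exact ⟨1, one_pos, by rw [hΛz, zero_mul]; linarith⟩
    · have hΛp : 0 < Λ := lt_of_le_of_ne hΛ0 (Ne.symm hΛz)
      refine ⟨ε / 2 / Λ, by positivity, ?_⟩
      rw [mul_div_cancel₀ _ hΛz]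
  have hη : 0 < δ * (ε / 2) ^ 2 := by positivity
  -- Cauchy window for `I`
  have hcau := (Metric.tendsto_atTop.1 hIlim) (δ * (ε / 2) ^ 2 / 2) (by positivity)
  obtain ⟨N, hN⟩ := hcau
  obtain ⟨t, htN, hgt⟩ := hcon (max N 0)
  have ht0 : 0 ≤ t := (le_max_right _ _).trans htN
  have htN' : N ≤ t := (le_max_left _ _).trans htN
  -- `g ≥ ε/2` on `[t, t + δ]`
  have hge : ∀ s ∈ Icc t (t + δ), ε / 2 ≤ g s := by
    intro s hs
    have h1 := hglip t s ht0 hs.1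
    have h2 : Λ * (s - t) ≤ ε / 2 := (mul_le_mul_of_nonneg_left (by linarith [hs.2]) hΛ0).trans hδ
    have h3 : dist (g t) 0 = g t := by rw [dist_zero_right, Real.norm_eq_abs, abs_of_nonneg (norm_nonneg _)]
    have hgt' : ε ≤ g t := by rw [← h3]; exact hgt
    have h4 : g t - g s ≤ ε / 2 := ((le_abs_self _).trans (by rw [abs_sub_comm]; exact h1)).trans h2
    linarith
  -- so `I(t+δ) − I(t) ≥ δ (ε/2)²`
  have hlow : δ * (ε / 2) ^ 2 ≤ I (t + δ) - I t := by
    have e : I (t + δ) - I t = ∫ s in t..t + δ, g s ^ 2 := by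
      rw [hI]
      simp only
      rw [← intervalIntegral.integral_add_adjacent_intervals (hgi 0 t) (hgi t (t + δ))]
      ring
    rw [e]
    have h1 : ∫ s in t..t + δ, (ε / 2) ^ 2 ≤ ∫ s in t..t + δ, g s ^ 2 :=
      intervalIntegral.integral_mono_on (by linarith) (intervalIntegrable_const) (hgi t (t + δ))
        fun s hs => pow_le_pow_left₀ (by positivity) (hge s hs) 2
    rw [intervalIntegral.integral_const, smul_eq_mul] at h1
    linarith
  -- contradiction with the Cauchy window
  have hIt : dist (I (max t 0)) (⨆ T : ℝ, I (max T 0)) < δ * (ε / 2) ^ 2 / 2 := hN t htN'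
  have hItδ : dist (I (max (t + δ) 0)) (⨆ T : ℝ, I (max T 0)) < δ * (ε / 2) ^ 2 / 2 :=
    hN (t + δ) (by linarith)
  rw [max_eq_left ht0] at hIt
  rw [max_eq_left (by linarith : (0 : ℝ) ≤ t + δ)] at hItδ
  have := dist_triangle_right (I (t + δ)) (I t) (⨆ T : ℝ, I (max T 0))
  rw [Real.dist_eq, abs_of_nonneg (by linarith : 0 ≤ I (t + δ) - I t)] at this
  linarith


end Summit.NavierStokesRegularity.NavierStokesRegularity.Theorems.PowerGaugeEulerLiouville.HalfOrbit

end
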